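import Summits.PneNP.PneNP.Theses.ExpanderLinearGenerators
import Literature.ModelTheory.FiniteModelTheory.CohomologicalConsistencyThreeColouringProofs

/-!
# Tseitin systems of finite graphs as sparse 𝔽₂-systems: support, unsolvability, boundary
# (route ExpanderLinearGenerators, helper for stmt-PneNP-11443 / stmt-PneNP-11442)

Route `PneNP/ExpanderLinearGenerators`.  The cruxes `LinearGeneratorDepthFregeHard`
(stmt-PneNP-11443) and `ExpansionForcesDepthFregeSize` (stmt-PneNP-11442) quantify over
`ℓ`-sparse systems `E : Fin m → LinEqMod 2 n` whose row supports form an `(r, 3ℓ/4)`-boundary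
expander (`IsBoundaryExpander`) and which are unsolvable.  The column-weight-`2` instances of this
class are the Tseitin systems of graphs: rows = vertices, variables = edges, the row of `v` sums
the edges at `v` to a charge `χ v`.  This file proves the three facts about them that the
instance file `ExpanderLinearGeneratorsLinearGeneratorDepthFregeHardInstances.lean` needs, for an
ARBITRARY finite simple graph `G` (rows and variables indexed through bijections
`Fin m ≃ V`, `Fin n ≃ E(G)`; the system is taken in hypothesis form `h1`/`h2`, no definition):
* `card_supp_of_incidence` — the row of `v` has `deg v` variables;
* `not_systemSat_of_incidence` — odd total charge makes the system unsolvable (every variable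
  lies in exactly two rows, `card_filter_mem_supp_of_incidence`);
* `sum_degree_le_boundary_add_of_incidence` — for a row set `F` with vertex set `U`,
  `Σ_{v ∈ U} deg v ≤ |∂F| + 2·e(U)` (`∂` = unique-neighbour boundary of the supports, `e(U)` =
  edges inside `U`, `edgesIn`), whence
* `isBoundaryExpander_of_isSparse` — if `G` is `ℓ`-regular with `ℓ ≥ 9` and `(s, 1/8)`-sparse
  (`IsSparse`: every `|U| ≤ s` spans `≤ (1 + 1/8)|U|` edges) then the supports form an
  `(r, 3ℓ/4)`-boundary expander for every `r ≤ s`, because `ℓ - 9/4 ≥ 3ℓ/4` iff `ℓ ≥ 9`.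

References: G. S. Tseitin (1968); A. Urquhart, Hard examples for resolution, J. ACM 34 (1987), §3–4
(graph formulas, odd charge); E. Ben-Sasson, A. Wigderson, J. ACM 48 (2001), §5–6 (boundary
expansion) [BenSassonWigderson2001]; J. Krajíček, *Proof Complexity* (CUP 2019), §13.3
[KrajicekProofComplexity2019].  All statements are folklore.
-/

set_option linter.dupNamespace false -- `Summit.PneNP.PneNP.…`: summit = sub-problem (D-0017)

namespace Summit.PneNP.PneNP.Theorems

open Literature.Computability.Complexity Literature.Computability.MetaComplexity
open Literature.ModelTheory.FiniteModelTheory.ConnerydGhannanePang (edgesIn mem_edgesIn IsSparse)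

/-! ### The Tseitin system of a finite graph (hypothesis form)

Rows are indexed by `Fin m ≃ V`, variables by `Fin n ≃ E(G)`; the row of a vertex has coefficient
`1` exactly at its incident edges and right-hand side the charge of the vertex.  We work with an
arbitrary `E` satisfying these two equations (`h1`, `h2`), so that no definition is introduced. -/

section GraphTseitin

variable {V : Type*} [Fintype V] [DecidableEq V] {G : SimpleGraph V} [DecidableRel G.Adj]
variable {m n : ℕ} {ev : Fin m ≃ V} {ee : Fin n ≃ G.edgeFinset} {χ : V → ZMod 2}
variable {E : Fin m → LinEqMod 2 n}

/-- In the Tseitin system the support of the row of `v` is the set of edges at `v`.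
[Urquhart 1987, §3 (Tseitin graph formulas)] [folklore] -/
theorem mem_supp_of_incidence
    (h1 : ∀ i j, (E i).1 j = if ev i ∈ ((ee j : G.edgeFinset) : Sym2 V) then 1 else 0)
    (i : Fin m) (j : Fin n) : j ∈ (E i).supp ↔ ev i ∈ ((ee j : G.edgeFinset) : Sym2 V) := by
  rw [LinEqMod.supp, Finset.mem_filter, h1]
  simp only [Finset.mem_univ, true_and, ne_eq, ite_eq_right_iff, one_ne_zero, imp_false,
    not_not]

/-- The row of `v` has exactly `deg v` variables. [Urquhart 1987, §3] [folklore] -/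
theorem card_supp_of_incidence
    (h1 : ∀ i j, (E i).1 j = if ev i ∈ ((ee j : G.edgeFinset) : Sym2 V) then 1 else 0)
    (i : Fin m) : (E i).supp.card = G.degree (ev i) := by
  rw [← G.card_incidenceFinset_eq_degree (ev i), G.incidenceFinset_eq_filter (ev i)]
  refine Finset.card_bij (fun j _ => ((ee j : G.edgeFinset) : Sym2 V)) ?_ ?_ ?_
  · intro j hj
    rw [Finset.mem_filter]
    exact ⟨(ee j).2, (mem_supp_of_incidence h1 i j).1 hj⟩
  · intro j₁ _ j₂ _ h
    exact ee.injective (Subtype.ext h)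
  · intro e he
    rw [Finset.mem_filter] at he
    refine ⟨ee.symm ⟨e, he.1⟩, ?_, ?_⟩
    · rw [mem_supp_of_incidence h1, Equiv.apply_symm_apply]
      exact he.2
    · simp

omit [DecidableRel G.Adj] in
/-- Exactly two vertices lie on an edge. [folklore] -/
theorem card_filter_mem_of_mem_edgeSet {e : Sym2 V} (he : e ∈ G.edgeSet) :
    (Finset.univ.filter fun v => v ∈ e).card = 2 := by
  induction e using Sym2.ind with
  | h x y =>
    have hxy : x ≠ y := G.ne_of_adj he
    have : (Finset.univ.filter fun v => v ∈ s(x, y)) = {x, y} := by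
      ext v
      simp [Sym2.mem_iff]
    rw [this, Finset.card_pair hxy]

/-- Exactly two rows of the Tseitin system contain a given variable. [Urquhart 1987, §3]
[folklore] -/
theorem card_filter_mem_supp_of_incidence
    (h1 : ∀ i j, (E i).1 j = if ev i ∈ ((ee j : G.edgeFinset) : Sym2 V) then 1 else 0)
    (j : Fin n) : (Finset.univ.filter fun i => j ∈ (E i).supp).card = 2 := by
  have he : ((ee j : G.edgeFinset) : Sym2 V) ∈ G.edgeSet :=
    SimpleGraph.mem_edgeFinset.1 (ee j).2
  have key : (Finset.univ.filter fun i => j ∈ (E i).supp).card =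
      (Finset.univ.filter fun v => v ∈ ((ee j : G.edgeFinset) : Sym2 V)).card := by
    refine Finset.card_bij (fun i _ => ev i) ?_ ?_ ?_
    · intro i hi
      rw [Finset.mem_filter] at hi ⊢
      exact ⟨Finset.mem_univ _, (mem_supp_of_incidence h1 i j).1 hi.2⟩
    · intro i₁ _ i₂ _ h
      exact ev.injective h
    · intro v hv
      rw [Finset.mem_filter] at hv
      refine ⟨ev.symm v, ?_, Equiv.apply_symm_apply ev v⟩
      rw [Finset.mem_filter, mem_supp_of_incidence h1, Equiv.apply_symm_apply]
      exact ⟨Finset.mem_univ _, hv.2⟩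
  rw [key]
  exact card_filter_mem_of_mem_edgeSet he

/-- **Odd total charge makes the Tseitin system unsolvable**: summing all equations counts every
variable twice. [Urquhart 1987, Lemma 4.1; Tseitin 1968] [folklore] -/
theorem not_systemSat_of_incidence
    (h1 : ∀ i j, (E i).1 j = if ev i ∈ ((ee j : G.edgeFinset) : Sym2 V) then 1 else 0)
    (h2 : ∀ i, (E i).2 = χ (ev i)) (hχ : ∑ v, χ v = 1) : ¬ SystemSat E Finset.univ := by
  rintro ⟨z, hz⟩
  have hrow : ∀ i, ∑ j, (E i).1 j * z j = χ (ev i) := fun i => (h2 i) ▸ hz i (Finset.mem_univ i)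
  have hsum : ∑ i, ∑ j, (E i).1 j * z j = 1 := by
    rw [← hχ, ← ev.sum_comp χ]
    exact Finset.sum_congr rfl fun i _ => hrow i
  have hcol : ∀ j, ∑ i, (E i).1 j = 0 := by
    intro j
    have hc : ∑ i, (E i).1 j = ∑ i, (if j ∈ (E i).supp then (1 : ZMod 2) else 0) :=
      Finset.sum_congr rfl fun i _ => by
        rw [h1]
        exact if_congr (mem_supp_of_incidence h1 i j).symm rfl rfl
    rw [hc, Finset.sum_boole, card_filter_mem_supp_of_incidence h1 j]
    decide
  rw [Finset.sum_comm] at hsum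
  have h0 : ∑ j, ∑ i, (E i).1 j * z j = 0 := by
    refine Finset.sum_eq_zero fun j _ => ?_
    rw [← Finset.sum_mul, hcol j, zero_mul]
  rw [h0] at hsum
  exact zero_ne_one hsum

/-- **Degree count of a row set.** For a set `F` of rows (vertex set `U`), the degrees of `U` sum
to at most `|∂F| + 2 e(U)`: an edge meets `U` in at most two vertices, in exactly one iff it is a
unique-neighbour (boundary) variable of `F`, and in two only if it lies inside `U`.
[Ben-Sasson–Wigderson 2001, §5 (boundary); folklore handshake] [folklore] -/
theorem sum_degree_le_boundary_add_of_incidence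
    (h1 : ∀ i j, (E i).1 j = if ev i ∈ ((ee j : G.edgeFinset) : Sym2 V) then 1 else 0)
    (F : Finset (Fin m)) :
    ∑ i ∈ F, G.degree (ev i) ≤
      (boundary (fun i => (E i).supp.map Fin.valEmbedding) F).card +
        2 * (edgesIn G (F.map ev.toEmbedding)).card := by
  -- `c j := #{i ∈ F | j ∈ supp (E i)}`, the number of rows of `F` containing the variable `j`
  -- (a) double counting
  have ha : ∑ i ∈ F, G.degree (ev i) = ∑ j, (F.filter fun i => j ∈ (E i).supp).card := by
    have : ∀ i ∈ F, G.degree (ev i) = ∑ j, if j ∈ (E i).supp then 1 else 0 := by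
      intro i _
      rw [← card_supp_of_incidence h1 i, Finset.sum_boole, Nat.cast_id, Finset.filter_univ_mem]
    rw [Finset.sum_congr rfl this, Finset.sum_comm]
    refine Finset.sum_congr rfl fun j _ => ?_
    rw [Finset.sum_boole, Nat.cast_id]
  -- (b) every variable lies in at most two rows
  have hb : ∀ j, (F.filter fun i => j ∈ (E i).supp).card ≤ 2 := fun j =>
    (Finset.card_le_card (Finset.filter_subset_filter _ (Finset.subset_univ F))).trans
      (card_filter_mem_supp_of_incidence h1 j).le
  -- (c) variables in exactly one row of `F` are boundary points of `F`
  have hc1 : (Finset.univ.filter fun j => (F.filter fun i => j ∈ (E i).supp).card = 1).card ≤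
      (boundary (fun i => (E i).supp.map Fin.valEmbedding) F).card := by
    refine Finset.card_le_card_of_injOn (fun j => Fin.valEmbedding j) ?_ ?_
    · intro j hj
      simp only [Finset.coe_filter, Set.mem_setOf_eq, Finset.mem_univ, true_and] at hj
      have hdeg : coverDegree (fun i => (E i).supp.map Fin.valEmbedding) F
          (Fin.valEmbedding j) = (F.filter fun i => j ∈ (E i).supp).card := by
        unfold coverDegree
        congr 1
        exact Finset.filter_congr fun i _ => by rw [Finset.mem_map' Fin.valEmbedding]
      obtain ⟨i, hi⟩ : (F.filter fun i => j ∈ (E i).supp).Nonempty :=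
        Finset.card_pos.1 (by omega)
      rw [Finset.mem_filter] at hi
      rw [Finset.mem_coe, mem_boundary, hdeg, mem_cover]
      exact ⟨⟨i, hi.1, by rw [Finset.mem_map' Fin.valEmbedding]; exact hi.2⟩, hj⟩
    · intro j₁ _ j₂ _ h
      exact Fin.valEmbedding.injective h
  -- (d) variables in two rows of `F` are edges inside `U`
  have hc2 : (Finset.univ.filter fun j => (F.filter fun i => j ∈ (E i).supp).card = 2).card ≤
      (edgesIn G (F.map ev.toEmbedding)).card := by
    refine Finset.card_le_card_of_injOn (fun j => ((ee j : G.edgeFinset) : Sym2 V)) ?_ ?_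
    · intro j hj
      simp only [Finset.coe_filter, Set.mem_setOf_eq, Finset.mem_univ, true_and] at hj
      have he : ((ee j : G.edgeFinset) : Sym2 V) ∈ G.edgeSet :=
        SimpleGraph.mem_edgeFinset.1 (ee j).2
      rw [Finset.mem_coe, mem_edgesIn]
      refine ⟨he, fun v hv => ?_⟩
      -- the two rows of `F` containing `j` are the two endpoints of the edge `j`
      have hTP : (F.filter fun i => j ∈ (E i).supp).image ev ⊆
          Finset.univ.filter fun w => w ∈ ((ee j : G.edgeFinset) : Sym2 V) := by
        intro w hw
        rw [Finset.mem_image] at hw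
        obtain ⟨i, hi, rfl⟩ := hw
        rw [Finset.mem_filter] at hi ⊢
        exact ⟨Finset.mem_univ _, (mem_supp_of_incidence h1 i j).1 hi.2⟩
      have hcard : (Finset.univ.filter fun w => w ∈ ((ee j : G.edgeFinset) : Sym2 V)).card ≤
          ((F.filter fun i => j ∈ (E i).supp).image ev).card := by
        rw [Finset.card_image_of_injective _ ev.injective, card_filter_mem_of_mem_edgeSet he, hj]
      have hPT := Finset.eq_of_subset_of_card_le hTP hcard
      have hvP : v ∈ Finset.univ.filter fun w => w ∈ ((ee j : G.edgeFinset) : Sym2 V) := by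
        rw [Finset.mem_filter]
        exact ⟨Finset.mem_univ _, hv⟩
      rw [← hPT, Finset.mem_image] at hvP
      obtain ⟨i, hi, rfl⟩ := hvP
      rw [Finset.mem_filter] at hi
      rw [Finset.mem_map]
      exact ⟨i, hi.1, rfl⟩
    · intro j₁ _ j₂ _ h
      exact ee.injective (Subtype.ext h)
  -- (e) assemble
  have he : ∀ j, (F.filter fun i => j ∈ (E i).supp).card ≤
      (if (F.filter fun i => j ∈ (E i).supp).card = 1 then 1 else 0) +
        2 * (if (F.filter fun i => j ∈ (E i).supp).card = 2 then 1 else 0) := fun j => by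
    have := hb j
    split_ifs <;> omega
  calc ∑ i ∈ F, G.degree (ev i) = ∑ j, (F.filter fun i => j ∈ (E i).supp).card := ha
    _ ≤ ∑ j, ((if (F.filter fun i => j ∈ (E i).supp).card = 1 then 1 else 0) +
          2 * (if (F.filter fun i => j ∈ (E i).supp).card = 2 then 1 else 0)) :=
        Finset.sum_le_sum fun j _ => he j
    _ = (Finset.univ.filter fun j => (F.filter fun i => j ∈ (E i).supp).card = 1).card +
          2 * (Finset.univ.filter fun j => (F.filter fun i => j ∈ (E i).supp).card = 2).card := by
        rw [Finset.sum_add_distrib, ← Finset.mul_sum, Finset.sum_boole, Finset.sum_boole,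
          Nat.cast_id, Nat.cast_id]
    _ ≤ (boundary (fun i => (E i).supp.map Fin.valEmbedding) F).card +
          2 * (edgesIn G (F.map ev.toEmbedding)).card := by omega

/-- **Small-set sparsity gives `(r, 3ℓ/4)`-boundary expansion for `ℓ ≥ 9`.** If `G` is
`ℓ`-regular, `ℓ ≥ 9`, and every vertex set `U` with `|U| ≤ s` spans at most `(1 + 1/8)|U|` edges,
then the row supports of its Tseitin system form an `(r, 3ℓ/4)`-boundary expander for every
`r ≤ s`: `|∂F| ≥ ℓ|F| - 2·(9/8)|F| = (ℓ - 9/4)|F| ≥ (3ℓ/4)|F|`.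
[Ben-Sasson–Wigderson 2001, §5–6; Krajíček 2019, §13.3] [folklore] -/
theorem isBoundaryExpander_of_isSparse
    (h1 : ∀ i j, (E i).1 j = if ev i ∈ ((ee j : G.edgeFinset) : Sym2 V) then 1 else 0)
    {ℓ : ℕ} (hreg : G.IsRegularOfDegree ℓ) (hℓ : 9 ≤ ℓ) {s : ℕ} (hsparse : IsSparse G s (1 / 8))
    {r : ℝ} (hr : r ≤ s) :
    IsBoundaryExpander (fun i => (E i).supp.map Fin.valEmbedding) r (3 / 4 * ℓ) := by
  intro F hF
  have hU : (F.map ev.toEmbedding).card = F.card := Finset.card_map _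
  have hUs : (F.map ev.toEmbedding).card ≤ s := by
    rw [hU]
    exact_mod_cast hF.trans hr
  have hsp := hsparse _ hUs
  rw [hU] at hsp
  have hmain := sum_degree_le_boundary_add_of_incidence h1 F
  have hdeg : ∑ i ∈ F, G.degree (ev i) = ℓ * F.card := by
    rw [Finset.sum_congr rfl fun i _ => hreg.degree_eq (ev i), Finset.sum_const, smul_eq_mul,
      mul_comm]
  rw [hdeg] at hmain
  have hmainR : (ℓ : ℝ) * F.card ≤
      (boundary (fun i => (E i).supp.map Fin.valEmbedding) F).card +
        2 * ((edgesIn G (F.map ev.toEmbedding)).card : ℝ) := by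
    exact_mod_cast hmain
  have hℓR : (9 : ℝ) ≤ ℓ := by exact_mod_cast hℓ
  have hk : (0 : ℝ) ≤ ((ℓ : ℝ) - 9) * F.card := mul_nonneg (by linarith) (Nat.cast_nonneg _)
  nlinarith [hmainR, hsp, hk]

end GraphTseitin

end Summit.PneNP.PneNP.Theorems
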